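import Literature.NumberTheory.Rogawski1990.UnitOrbitalIntegralInertClosedFormsTypeTwo      -- ★ B-p14 (g30): `phiTHM`, `phiTHprimeM`, `phiTHn`, `phiTHprimen`
import HarnessLib

/-!
# The type-(2) closed forms at the OBSERVABLE exponents: `phiTHn q n N = phiTHM q N₊ N` and `phiTHprimen q n N = phiTHprimeM q N₊ N` when `n = min(2N+1, 2N₊)`
(Flicker (1998), *Elementary proof of the fundamental lemma for a unitary group*, Prop. 11 p. 87, Prop. 17 p. 97, proof of Theorem 18 p. 97: `t₁ − 1 ∈ π_{EL}^n R_{EL}^×`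
with `n = min(1 + 2N, 2 + 2N₂)`, `N₊ = N₂ + 1`)

Topic `NumberTheory/Rogawski1990`; namespace `Literature.NumberTheory.Rogawski1990.Flicker1998`.  THEOREMS ONLY (no `def`, no instance, no notation, no named fact,
no `sorry`).  Cell `pub/hodgecm-mathlib`, programme P3a, road «D-N7-inert», «N7nsCount» ED. 1.5: the TABLE IDENTITY (P2) of architect A-p06 (g26)'s 06:45:39Z ruling —
the link between the `(M, N)`-indexed closed forms (★ A-p03 p841886 ∕ p841959: `#Fix_{U⧸K}(t′) = phiTHM q N₊ N`, `N₊ = ord(A − b₀)`; Prop. 16 ∕ 17 LAYER B′: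
`phiTHprimeM q N₊ N`) and the `(n, N)`-indexed wrappers the registered value stubs `stub_irredGValuePos` ∕ `stub_irredGValueNeg` print (`n = ord_w χ_g(u) =
min(2N+1, 2N₊)`).  Rider by B-p12 (g28).  HC_CM is proved only modulo the printed citations (2 remaining named inputs hLiu418, h413) until rung 0 closes.

MATHEMATICS.  If `N₊ ≤ N` then `n = 2N₊` is even and `n ∕ 2 = N₊` — nothing to prove.  If `N < N₊` then `n = 2N + 1` is odd, the wrapper evaluates at `M := N + 1`,
and both `phiTHM q · N` and `phiTHprimeM q · N` are CONSTANT in `M` on `N < M` (`phiTHM`: the branch `N < M` depends on `N` only; `phiTHprimeM`: `N < M ⇒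
min([N∕2] + 1, [(M+1)∕2]) = [N∕2] + 1`).

References: [Flicker1998UnitaryFL] Y. Z. Flicker, Canad. J. Math. 50 (1998), Prop. 11 p. 87, Prop. 17 p. 97, Theorem 18 p. 97. -/

set_option autoImplicit false

namespace Literature.NumberTheory.Rogawski1990.Flicker1998

/-- `Φ(t)` is constant in `M` on the stratum `N < M` (the branch `N < M` of `phiTHM` depends on `N` only). [cite: Flicker1998UnitaryFL, Prop. 11 p. 87] -/
theorem phiTHM_of_lt {q M M' N : ℕ} (h : N < M) (h' : N < M') : phiTHM q M N = phiTHM q M' N := by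
  unfold phiTHM
  rw [if_pos h, if_pos h']

/-- `Φ′(t″)` is constant in `M` on the stratum `N < M` (`min([N∕2]+1, [(M+1)∕2]) = [N∕2]+1` there). [cite: Flicker1998UnitaryFL, Prop. 17 p. 97] -/
theorem phiTHprimeM_of_lt {q M M' N : ℕ} (h : N < M) (h' : N < M') : phiTHprimeM q M N = phiTHprimeM q M' N := by
  unfold phiTHprimeM
  rw [if_pos h, if_pos h', min_eq_left (by omega : N / 2 + 1 ≤ (M + 1) / 2), min_eq_left (by omega : N / 2 + 1 ≤ (M' + 1) / 2)]

/-- **(P2), `κ = +1`: `phiTHn q n N = phiTHM q N₊ N` for `n = min(2N+1, 2N₊)`** — the observable-exponent wrapper of the registered value stub agrees with the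
`(M, N)`-indexed closed form at `M = N₊ = ord(A − b₀)`. [cite: Flicker1998UnitaryFL, Prop. 11 p. 87; Theorem 18 p. 97] -/
theorem phiTHn_eq_phiTHM_of_eq_min {q n N Np : ℕ} (hn : n = min (2 * N + 1) (2 * Np)) : phiTHn q n N = phiTHM q Np N := by
  unfold phiTHn
  rcases le_or_gt Np N with hle | hlt
  · have hn' : n = 2 * Np := by rw [hn]; exact min_eq_right (by omega)
    rw [if_pos (by omega), hn', Nat.mul_div_cancel_left _ two_pos]
  · have hn' : n = 2 * N + 1 := by rw [hn]; exact min_eq_left (by omega)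
    rw [if_neg (by omega)]
    exact phiTHM_of_lt (Nat.lt_succ_self N) hlt

/-- **(P2), `κ = −1`: `phiTHprimen q n N = phiTHprimeM q N₊ N` for `n = min(2N+1, 2N₊)`.** [cite: Flicker1998UnitaryFL, Prop. 17 p. 97; Theorem 18 p. 97] -/
theorem phiTHprimen_eq_phiTHprimeM_of_eq_min {q n N Np : ℕ} (hn : n = min (2 * N + 1) (2 * Np)) : phiTHprimen q n N = phiTHprimeM q Np N := by
  unfold phiTHprimen
  rcases le_or_gt Np N with hle | hlt
  · have hn' : n = 2 * Np := by rw [hn]; exact min_eq_right (by omega)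
    rw [if_pos (by omega), hn', Nat.mul_div_cancel_left _ two_pos]
  · have hn' : n = 2 * N + 1 := by rw [hn]; exact min_eq_left (by omega)
    rw [if_neg (by omega)]
    exact phiTHprimeM_of_lt (Nat.lt_succ_self N) hlt

end Literature.NumberTheory.Rogawski1990.Flicker1998
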